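import Summits.ABC.IUTFork.Repair.RHQ3LTailSigma8Window
import Summits.ABC.IUTFork.Repair.RHQ3LTailSigma8Target
import HarnessLib

/-!
# D-0079 RESCUE sub-cell R-H, ROUND 2 Q3 — «YES PER DATUM, NOT UNIFORMLY»: the UNIFORM l-tail of row 8 (one `l₀` for ALL curves) is FALSE
# MODULO the existence of heavy genuine data (seat abc-iut-rh2-q3-typ-1 g2)

Companion of `RHQ3LTailSigma8Target` p479487 (`LTailSigma8 F E` — per curve — PROVED) and `RHQ3LTailSigma8Window` p479646 (`not_inSigma8_of_heavy`: ONE bad place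
with `4·l·e(v|p)·(⌊log_p e_w⌋ + 2) + 2 ≤ (l−3)·ord_v(q_v)` puts the datum OUTSIDE Σ₈). Rung LADDER-ABC:A2.RESCUE.H; ROUND2 READING §Q3 «YES PER DATUM, NOT
UNIFORMLY … no l serves all data» — so far «in substance, not kernel» (g0 `RHQ3LTail` docstring: «a kernel ¬ needs admissible data of unbounded local height at
fixed l»). This file types the uniform reading as ONE claim-tagged Prop `UniformLTailSigma8` (quantifier order `∃ l₀ ∀ curves`, vs `LTailSigma8`'s
`∀ curve ∃ l₀`) and proves `¬ UniformLTailSigma8` MODULO an explicitly displayed EXISTENCE input `HeavyGaloisData` — «at arbitrarily large levels `l` there is a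
[IUTchI] Def. 3.1 datum with `K/ℚ` Galois and one bad place that is heavy at `l`» (e.g. Frey–Hellegouarch curves of abc-triples with a large prime power and
surjective mod-`l` image; NOT constructed in the tree: the (P7)-existence of Θ-data is an open construction item of branch C) — consumed as a HYPOTHESIS, never
asserted. TAKES NO SIDE on [IUTchIII] Cor. 3.12 or on any author; nothing here asserts abc; `InSigma8`/`HBand` are row 8's hypothesis vocabulary BY NAME.

* `UniformLTailSigma8` (def, claim-tagged target): `∃ l₀, ∀ l ≥ l₀, ∀ (F, E), ∀ data D of level l over (F, E) with K/ℚ Galois, InSigma8 D`.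
* `uniformLTailSigma8_imp_lTailSigma8` — the uniform reading implies the per-curve one (bookkeeping; the converse is what fails).
* **`not_uniformLTailSigma8_of_heavyGaloisData`** — `HeavyGaloisData → ¬ UniformLTailSigma8` (`not_inSigma8_of_heavy` at the witness datum).
* `heavy_of_localHeight` — the arithmetic shape of «heavy at `l`»: `e(v|p)·(10·(⌊log_p e_w⌋ + 2) + 1) ≤ ord_v(q_v)` (normalised local height
  `H_v ≥ 10⌊log_p e_w⌋ + 21`) implies the heavy inequality at every `l ≥ 5`.
[cite: Mochizuki2012, IUTchI Def. 3.1 (b)(c) pp. 61–62, Ex. 3.2 (iv) p. 71; IUTchIV Prop. 1.2 (i)(ii) p. 10] [claim: Mochizuki2012, status: disputed] for every IUT locution.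
-/

noncomputable section

open Set Function NumberField IsDedekindDomain

namespace Summit.ABC.IUTFork.Repair.RH.Q3LTailSigma8

open Literature.IUT.LogThetaLattice Literature.IUT.LogVolume Literature.IUT.HodgeTheaters
open Summit.ABC.IUTFork.Thm311 Summit.ABC.IUTFork.Thm311.Real Summit.ABC.IUTFork.Cor312Prov

/-! ## §1. The uniform reading as a Prop, and its relation to the per-curve target -/

/-- **Q3, UNIFORM READING of row 8** [R-H round 2, kernel target — expected FALSE]: «ONE `l₀` such that for every `l ≥ l₀`, EVERY curve `(F, E_F)` and EVERY
[IUTchI] Def. 3.1 datum of level `l` over it with `K/ℚ` Galois lies in Σ₈» (`RH.InSigmaDatum.InSigma8`). Compare `LTailSigma8 F E` (per curve, PROVED): here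
`l₀` precedes the curve. Refuted below modulo the existence input `HeavyGaloisData`. [R-H target over a HYPOTHESIS class — not a fact about S]
[cite: Mochizuki2012, IUTchI Def. 3.1 pp. 61–63] [claim: Mochizuki2012, status: disputed] -/
@[claim "Mochizuki2012" "disputed"]
def UniformLTailSigma8 : Prop :=
  ∃ l₀ : ℕ, ∀ l : ℕ, l₀ ≤ l →
    ∀ (F : Type) [Field F] [NumberField F] (E : WeierstrassCurve F) [E.IsElliptic]
      (K Fbar : Type) [Field K] [NumberField K] [Algebra F K] [Field Fbar] [Algebra F Fbar] [Algebra K Fbar]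
      (Pb : BadPlacePredicates K) (D : InitialThetaData F K Fbar E l Pb), IsGalois ℚ K → RH.InSigmaDatum.InSigma8 D

/-- The uniform reading implies the per-curve target `LTailSigma8 F E` for every curve (quantifier bookkeeping). [folklore] -/
theorem uniformLTailSigma8_imp_lTailSigma8 (h : UniformLTailSigma8) (F : Type) [Field F] [NumberField F] (E : WeierstrassCurve F) [E.IsElliptic] :
    LTailSigma8 F E := by
  obtain ⟨l₀, h⟩ := h
  exact ⟨l₀, fun l hl K Fbar _ _ _ _ _ _ Pb D hGal => h l hl F E K Fbar Pb D hGal⟩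

/-! ## §2. The existence input and the refutation modulo it -/

/-- **EXISTENCE INPUT «heavy Galois data at arbitrarily large levels»** (a HYPOTHESIS of this file, NOT constructed in the tree): for every `l₀` there are a
level `l ≥ l₀`, a curve `(F, E_F)`, and a [IUTchI] Def. 3.1 datum `D` of level `l` over it with `K/ℚ` Galois and ONE bad place `w | p` that is HEAVY at `l`:
`4·l·e(v|p)·(⌊log_p e_w⌋ + 2) + 2 ≤ (l − 3)·ord_v(q_v)` (the hypothesis of `not_inSigma8_of_heavy`). Intended witnesses: Frey–Hellegouarch curves of abc-triples
with one large prime power (local height `≫ log l`) and surjective mod-`l` Galois image; their Θ-data are branch C's (P7)-existence item. Stated inline as the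
binder of the next theorem; this `def` only NAMES it. [claim: Mochizuki2012, status: disputed] -/
@[claim "Mochizuki2012" "disputed"]
def HeavyGaloisData : Prop :=
  ∀ l₀ : ℕ, ∃ l : ℕ, l₀ ≤ l ∧
    ∃ (F : Type) (_ : Field F) (_ : NumberField F) (E : WeierstrassCurve F) (_ : E.IsElliptic)
      (K Fbar : Type) (_ : Field K) (_ : NumberField K) (_ : Algebra F K) (_ : Field Fbar) (_ : Algebra F Fbar) (_ : Algebra K Fbar)
      (Pb : BadPlacePredicates K) (D : InitialThetaData F K Fbar E l Pb), IsGalois ℚ K ∧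
      ∃ (pp : Nat.Primes) (w : (thetaIndex (pilotDataOfK D K)).Fibre (.inr pp)),
        haveI : Fact (pp : ℕ).Prime := ⟨pp.2⟩
        placeOf (pilotDataOfK D K) pp.1 w ∈ (pilotDataOfK D K).S ∧
          4 * l * ramIdx F (finBelow F K (placeOf (pilotDataOfK D K) pp.1 w)) *
                (Nat.log (pp : ℕ) (ramIdx K (placeOf (pilotDataOfK D K) pp.1 w)) + 2) + 2 ≤
            (l - 3) * qParamOrd E (finBelow F K (placeOf (pilotDataOfK D K) pp.1 w))

/-- **«NOT UNIFORMLY», in kernel modulo existence.** If heavy Galois data exist at arbitrarily large levels (`HeavyGaloisData`), the uniform l-tail of row 8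
FAILS: `¬ UniformLTailSigma8` — at the witness level `l ≥ l₀` the witness datum is outside Σ₈ by `not_inSigma8_of_heavy` (p479646). Together with
`lTailSigma8_holds` (per curve YES) this is the quantifier structure of the booked word «Q3: YES PER DATUM, NOT UNIFORMLY».
[cite: Mochizuki2012, IUTchI Def. 3.1 (b)(c) pp. 61–62; IUTchIV Prop. 1.2 (i)(ii) p. 10] [claim: Mochizuki2012, status: disputed] -/
theorem not_uniformLTailSigma8_of_heavyGaloisData (hheavy : HeavyGaloisData) : ¬ UniformLTailSigma8 := by
  rintro ⟨l₀, h⟩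
  obtain ⟨l, hl, F, _, _, E, _, K, Fbar, _, _, _, _, _, _, Pb, D, hGal, pp, w, hw, hheavy⟩ := hheavy l₀
  exact not_inSigma8_of_heavy D pp w hw hheavy (h l hl F E K Fbar Pb D hGal)

/-! ## §3. The arithmetic shape of «heavy at `l`» from an l-free local-height bound -/

/-- **l-FREE HEAVINESS ⟹ HEAVY AT EVERY `l ≥ 5`.** If `e_v·(10·(T + 2) + 1) ≤ n` (normalised local height `n/e_v ≥ 10T + 21`) then
`4·l·e_v·(T + 2) + 2 ≤ (l − 3)·n` for every `l ≥ 5` (`4l ≤ 10(l−3)`, `2 ≤ (l−3)·e_v`). With `T := ⌊log_p e_w⌋` this is the binder of `not_inSigma8_of_heavy`;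
note `e_w` itself grows with `l` (`l ∣ e_w`), so along one curve `T ≍ log_p l` — the heavy FAMILY needs local heights `≳ log l`, unbounded. [folklore] -/
theorem heavy_of_localHeight {l ev n T : ℕ} (hl : 5 ≤ l) (hev : 1 ≤ ev) (h : ev * (10 * (T + 2) + 1) ≤ n) :
    4 * l * ev * (T + 2) + 2 ≤ (l - 3) * n := by
  obtain ⟨m, rfl⟩ := Nat.exists_eq_add_of_le hl
  have h53 : 5 + m - 3 = 2 + m := by omega
  rw [h53]
  have h1 : (2 + m) * (ev * (10 * (T + 2) + 1)) ≤ (2 + m) * n := Nat.mul_le_mul_left _ h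
  have key : (2 + m) * (ev * (10 * (T + 2) + 1)) = 4 * (5 + m) * ev * (T + 2) + 2 * ev + 6 * (m * ev * (T + 2)) + m * ev := by ring
  rw [key] at h1
  linarith [hev, Nat.zero_le (m * ev * (T + 2)), Nat.zero_le (m * ev)]

end Summit.ABC.IUTFork.Repair.RH.Q3LTailSigma8

end
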